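/-
Copyright: the b2b-balaban T⁴-continuum CRUX team, row NE7b leaf lineage `t4-ne7b-formalise-leaf-04` (gen 155). Project licence.
-/
import Literature.Analysis.Convex.ProximalMap

/-!
# TWO SOFT STEPS ARE ONE SOFT STEP — RESISTANCES ADD EXACTLY: the quadratic kernels compose,
# `min_z [‖y − z‖²∕(2μ) + ‖z − x‖²∕(2λ)] = ‖y − x‖²∕(2(λ+μ))` at `z = x + (λ∕(λ+μ))(y − x)`, so for ANY `f` and ANY inner window `K`
# the `λ`-step of the `μ`-envelope IS the `(λ+μ)`-step (`e_λ(e_μ f) = e_{λ+μ} f`, same minimiser, intermediate point on the segment), and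
# in the tree's `prox` currency `prox ((λ+μ)•f) x = prox (μ•f) (x + (λ∕(λ+μ))(prox ((λ+μ)•f) x − x))` (the resolvent identity)
# (row NE7b, node U5c; residual (R2′) family (2): the TOWER of classical soft steps; [folklore] — Bauschke–Combettes Prop. 12.22 ∕ 23.28)

Cell `pub-balaban`, sub-cell `t4`, spine estimate NE7b (`T4WeightBudget.RelWeightBound`; the cell's OWN estimate — NOT PRINTED in
[Bałaban 1983–89], NOT PROVED).  Crux-route work under `Spine/NE7b/` by leaf-04 on the convexity road; NOTHING of Bałaban's is named or
asserted; no `T4Continuum/Support` leaf typed; no `def`; zero `sorry`.  Imports: the tree's BUILT `Literature.Analysis.Convex.ProximalMap`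
(`proxFun f x z = f z + ‖z − x‖²∕2`, `prox`, `isMinOn_prox`, `IsMinOn.eq_of_isMinOn_proxFun`) only — independent of the `Spine/NE7b` olean
frontier; this lineage's `…MoreauEnvelopeLetters` (MEL) ∕ `…WindowedMoreauEnvelope` (WME) ∕ `…AveragingFloorTower` (AFT) and the tree's
`…BIJ85ScalarFormSemigroup` are NOT imported (their one-step letters ∕ floor recursion ∕ Gaussian form semigroup are what this file's identity
composes, generalises or sharpens; nothing of theirs is restated).  PRIOR ART IN THE TREE, located: `BIJ85ScalarFormSemigroup.oneStep_le ∕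
oneStep_attained` (§1 there) is the kernel INEQUALITY and its attainment for a linear `Q` with `‖Qδ‖² ≤ N⁻¹‖δ‖²` — at `Q = 1`, `N = 1` it is
this file's `kernel_semigroup_le`; NEW here are the exact identity with its remainder and the uniqueness of the intermediate point (§1), the
composition at the level of an arbitrary `f` and window (§2), and the resolvent identity in `prox` currency (§3).

WHY.  MEL ∕ WME type ONE soft (quadratic-penalty) step `e(x) = min_y [f y + ½‖y − x‖²]` and its letters (gradient `x − p x`, growth `½`,
modulus `m∕(1+m)`: «resistances add»); AFT types the TOWER of such steps in FLOOR currency as an inequality recursion `γ′⁻¹ ≤ a⁻¹ + q²γ⁻¹`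
(print's `a_k`, [B1] (2.13)–(2.15), by name); `BIJ85ScalarFormSemigroup` types the EXACT Gaussian semigroup for QUADRATIC data.  THIS FILE
types the exact composition law UNDERNEATH all three, for ARBITRARY `f` (no convexity, no finite dimension) and any inner window `K`: the
penalty kernels themselves form a semigroup in the parameter (§1: the infimum over the intermediate point of two quadratic kernels with weights
`(2μ)⁻¹`, `(2λ)⁻¹` is the quadratic kernel with weight `(2(λ+μ))⁻¹` — resistances `λ`, `μ` in series ADD — attained at the point of the
segment `[x, y]` at parameter `λ∕(λ+μ)`, uniquely), hence (§2) a `μ`-step followed by a `λ`-step IS a `(λ+μ)`-step: same minimiser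
(`q z⋆` = the `(λ+μ)`-proximal point), same value (`e_λ(e_μ f) = e_{λ+μ} f` at the minimisers), and the intermediate kept variable `z⋆` lies
ON THE SEGMENT from `x` to the minimiser — and conversely.  So MEL ∕ WME's letters apply to any finite stretch of a tower of soft steps AT
ONCE with parameter `Σλ_j`, AFT's reciprocal recursion is this identity's modulus shadow (equality in the quadratic model, §4), and in the
tree's `prox` currency (§3) the law is the RESOLVENT IDENTITY `J_{λ+μ} = J_μ((μ∕(λ+μ))·id + (λ∕(λ+μ))·J_{λ+μ})` — with unit kernels: the
proximal point of the envelope is the MIDPOINT of `x` and `prox (2•f) x`.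

WHAT IS PROVED ([folklore]: Moreau 1965; Attouch, *Variational Convergence* (1984) §3.1; Bauschke–Combettes 2011 Prop. 12.22
(`{}^{γ}({}^{μ}f) = {}^{γ+μ}f`) and Prop. 23.28 (resolvent identity) — proved here from one polarisation identity, nothing cited as a fact).
`E` a real inner product space; `λ, μ > 0`; `f : E → ℝ`; `K ⊆ E`; the `μ`-step functional at `z` is WRITTEN OUT as `y ↦ f y + ‖y − z‖²∕(2μ)`.
* §1 THE KERNEL SEMIGROUP: **`kernel_semigroup`** (`‖y − z‖²∕(2μ) + ‖z − x‖²∕(2λ) = ‖y − x‖²∕(2(λ+μ)) + ((λ+μ)∕(2λμ))·‖(z − x) − (λ∕(λ+μ))•(y − x)‖²`),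
  `kernel_semigroup_le` (the `(λ+μ)`-kernel is a lower bound), `kernel_semigroup_eq` (equality at `z = x + (λ∕(λ+μ))•(y − x)`),
  **`kernel_semigroup_eq_iff`** (equality ONLY there).
* §2 TWO STEPS = ONE STEP, ANY `f`, ANY INNER WINDOW `K`: `twoStep_ge_oneStep` (the joint functional dominates the `(λ+μ)`-functional),
  **`isMinOn_oneStep_of_twoStep`** (a selection `q` of inner `μ`-step minimisers on `K` + an outer minimiser `z⋆` of
  `z ↦ [f (q z) + ‖q z − z‖²∕(2μ)] + ‖z − x‖²∕(2λ)` ⟹ `q z⋆` minimises `y ↦ f y + ‖y − x‖²∕(2(λ+μ))` on `K`), **`twoStep_value_eq`**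
  (`e_λ(e_μ f)(x) = e_{λ+μ} f(x)` at the minimisers), **`intermediate_eq_of_twoStep`** (`z⋆ = x + (λ∕(λ+μ))•(q z⋆ − x)`); conversely
  **`isMinOn_innerStep_of_oneStep`** (a `(λ+μ)`-minimiser `y⋆` minimises the inner `μ`-step at `z⋆ := x + (λ∕(λ+μ))•(y⋆ − x)`) and
  **`isMinOn_outerStep_of_oneStep`** (that `z⋆` minimises the outer `λ`-step of the `μ`-envelope, for ANY selection `q`).
* §3 IN THE TREE's `prox` CURRENCY (`E` finite-dimensional, `f` convex on `univ`): `isMinOn_step_iff_isMinOn_proxFun_smul` (the `μ`-step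
  minimisers are the minimisers of `proxFun (μ•f) z`; any normed group), `isMinOn_step_prox_smul` (the tree's `prox (μ•f)` is a selection),
  **`prox_smul_add_eq_prox_smul_intermediate`** (THE RESOLVENT IDENTITY
  `prox ((λ+μ)•f) x = prox (μ•f) (x + (λ∕(λ+μ))•(prox ((λ+μ)•f) x − x))`), **`prox_comp_of_outerStep`** (any outer minimiser `z⋆` has
  `prox (μ•f) z⋆ = prox ((λ+μ)•f) x` and `z⋆ = x + (λ∕(λ+μ))•(prox ((λ+μ)•f) x − x)`), `prox_two_smul_eq` (unit kernels: `prox (2•f) x =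
  prox f (midpoint ℝ x (prox (2•f) x))`).
* §4 RESISTANCES ADD EXACTLY (kernel `example`s): the modulus bookkeeping `m ↦ m∕(1+μm) ↦ m∕(1+(λ+μ)m)` of the quadratic model, and the unit
  case `m∕(1+m)` twice `= m∕(1+2m)` — the equality case of MEL ∕ WME's `m∕(1+m)` and of AFT's reciprocal recursion.

NOT HERE (honest): the operator-`P` version of §1 (two AVERAGING steps `min_z [a₁‖z − P₁y‖² + a₂‖x − P₂z‖²] = a₁₂‖x − P₂P₁y‖²` with
`a₁₂⁻¹ = a₂⁻¹ + c·a₁⁻¹` for a co-isometric `P₂P₂* = c·1` — the mechanism of print's `a_k`; AFT `floor_of_sum` is its inequality half,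
`BIJ85ScalarFormSemigroup` its quadratic-data form); a window on the INTERMEDIATE variable (the segment point must then be admissible); existence
of outer minimisers in §2 (displayed as a hypothesis; in §3's setting MEL's convexity of the envelope + the tree's `exists_isMinOn_proxFun` give
it — not imported); which steps of print are soft classical steps in which chart ((A3) ∕ (A1c), NC-NE7b-α UNRULED); anything of Bałaban's.
BY-NAME EFFECT ON THE WALL: NONE.  NE7b NOT PRINTED ∕ NOT PROVED; spine PROVED 0∕9; rung (B)+1 on a FINITE torus — NOT infinite volume, NOT
the mass gap, NOT Clay.  HONEST DEPENDENCY: continuum YM on T⁴ ⇐ BetaPertH ∧ nine spine estimates (0/9 proved); BetaPertH ⇐ (D1) ∧ (D4) ∧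
CAP+tail; G-an2-4 gates asym, D1 and NE2∕3∕4.
-/

set_option autoImplicit false

noncomputable section

namespace Summit.QuantumFields.BalabanUV.T4Continuum.NE7b.SoftStepSemigroup

open Set InnerProductSpace
open scoped RealInnerProductSpace
open Literature.Analysis.Convex

variable {E : Type*} [NormedAddCommGroup E] [InnerProductSpace ℝ E]
variable {f : E → ℝ} {K : Set E} {x y z : E} {lam mu : ℝ} {q : E → E}

/-! ## §1 The kernel semigroup: two quadratic penalties in series are one, resistances `λ`, `μ` add -/

/-- **THE KERNEL SEMIGROUP IDENTITY**: for `λ, μ > 0` and all `x y z`,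
`‖y − z‖²∕(2μ) + ‖z − x‖²∕(2λ) = ‖y − x‖²∕(2(λ+μ)) + ((λ+μ)∕(2λμ))·‖(z − x) − (λ∕(λ+μ))•(y − x)‖²` — one polarisation. [folklore] -/
theorem kernel_semigroup (hl : 0 < lam) (hm : 0 < mu) (x y z : E) :
    ‖y - z‖ ^ 2 / (2 * mu) + ‖z - x‖ ^ 2 / (2 * lam) =
      ‖y - x‖ ^ 2 / (2 * (lam + mu)) + (lam + mu) / (2 * lam * mu) * ‖(z - x) - (lam / (lam + mu)) • (y - x)‖ ^ 2 := by
  have hlm : lam + mu ≠ 0 := (add_pos hl hm).ne'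
  have e0 : y - z = (y - x) - (z - x) := by abel
  rw [e0, norm_sub_sq_real (y - x) (z - x), norm_sub_sq_real (z - x) ((lam / (lam + mu)) • (y - x)), real_inner_smul_right,
    norm_smul, Real.norm_eq_abs, abs_of_pos (div_pos hl (add_pos hl hm)), mul_pow, real_inner_comm (z - x) (y - x)]
  field_simp
  ring

/-- **THE `(λ+μ)`-KERNEL IS A LOWER BOUND** for the two kernels in series, at every intermediate point `z`. [folklore] -/
theorem kernel_semigroup_le (hl : 0 < lam) (hm : 0 < mu) (x y z : E) :
    ‖y - x‖ ^ 2 / (2 * (lam + mu)) ≤ ‖y - z‖ ^ 2 / (2 * mu) + ‖z - x‖ ^ 2 / (2 * lam) := by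
  rw [kernel_semigroup hl hm x y z]
  have : 0 ≤ (lam + mu) / (2 * lam * mu) * ‖(z - x) - (lam / (lam + mu)) • (y - x)‖ ^ 2 := by positivity
  linarith

/-- **EQUALITY AT THE SEGMENT POINT** `z = x + (λ∕(λ+μ))•(y − x)` (= the convex combination `(μ x + λ y)∕(λ+μ)`). [folklore] -/
theorem kernel_semigroup_eq (hl : 0 < lam) (hm : 0 < mu) (x y : E) :
    ‖y - (x + (lam / (lam + mu)) • (y - x))‖ ^ 2 / (2 * mu) + ‖(x + (lam / (lam + mu)) • (y - x)) - x‖ ^ 2 / (2 * lam) =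
      ‖y - x‖ ^ 2 / (2 * (lam + mu)) := by
  rw [kernel_semigroup hl hm, add_sub_cancel_left, sub_self, norm_zero]
  ring

/-- **EQUALITY ONLY THERE**: the two kernels in series equal the `(λ+μ)`-kernel iff `z` is the segment point. [folklore] -/
theorem kernel_semigroup_eq_iff (hl : 0 < lam) (hm : 0 < mu) (x y z : E) :
    ‖y - z‖ ^ 2 / (2 * mu) + ‖z - x‖ ^ 2 / (2 * lam) = ‖y - x‖ ^ 2 / (2 * (lam + mu)) ↔
      z = x + (lam / (lam + mu)) • (y - x) := by
  constructor
  · intro h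
    rw [kernel_semigroup hl hm x y z] at h
    have hc : 0 < (lam + mu) / (2 * lam * mu) := by positivity
    have h0 : (lam + mu) / (2 * lam * mu) * ‖(z - x) - (lam / (lam + mu)) • (y - x)‖ ^ 2 = 0 := by linarith
    rcases mul_eq_zero.1 h0 with h1 | h1
    · exact absurd h1 hc.ne'
    · rw [sq_eq_zero_iff, norm_eq_zero, sub_eq_zero] at h1
      rw [← h1, add_sub_cancel]
  · rintro rfl
    exact kernel_semigroup_eq hl hm x y

/-! ## §2 Two soft steps are one soft step — any `f`, any inner window `K` -/

/-- **THE JOINT TWO-STEP FUNCTIONAL DOMINATES THE ONE-STEP FUNCTIONAL**: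
`f y + ‖y − x‖²∕(2(λ+μ)) ≤ f y + ‖y − z‖²∕(2μ) + ‖z − x‖²∕(2λ)`, with equality at the segment point (§1). [folklore] -/
theorem twoStep_ge_oneStep (hl : 0 < lam) (hm : 0 < mu) (f : E → ℝ) (x y z : E) :
    f y + ‖y - x‖ ^ 2 / (2 * (lam + mu)) ≤ f y + ‖y - z‖ ^ 2 / (2 * mu) + ‖z - x‖ ^ 2 / (2 * lam) := by
  have := kernel_semigroup_le hl hm x y z
  linarith

/-- **A `μ`-STEP THEN A `λ`-STEP IS A `(λ+μ)`-STEP — THE MINIMISER.**  Let `q` select inner `μ`-step minimisers on the window `K`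
(`q z ∈ K`, `IsMinOn (y ↦ f y + ‖y − z‖²∕(2μ)) K (q z)` for every `z`) and let `z⋆` minimise the outer `λ`-step of the `μ`-envelope,
`z ↦ [f (q z) + ‖q z − z‖²∕(2μ)] + ‖z − x‖²∕(2λ)`, over `E`.  Then `q z⋆` minimises the `(λ+μ)`-step `y ↦ f y + ‖y − x‖²∕(2(λ+μ))` on `K`.
No convexity, no dimension. [folklore] -/
theorem isMinOn_oneStep_of_twoStep (hl : 0 < lam) (hm : 0 < mu)
    (hq : ∀ z, IsMinOn (fun y => f y + ‖y - z‖ ^ 2 / (2 * mu)) K (q z)) {zs : E}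
    (hzs : IsMinOn (fun z => (f (q z) + ‖q z - z‖ ^ 2 / (2 * mu)) + ‖z - x‖ ^ 2 / (2 * lam)) univ zs) :
    IsMinOn (fun y => f y + ‖y - x‖ ^ 2 / (2 * (lam + mu))) K (q zs) := by
  intro y hy
  -- one(y) = F(y, ẑ) ≥ g(ẑ) + kernel(ẑ) ≥ g(z⋆) + kernel(z⋆) = F(q z⋆, z⋆) ≥ one(q z⋆), with ẑ the segment point of `[x, y]`
  have h1 := kernel_semigroup_eq hl hm x y
  have h2 : f (q (x + (lam / (lam + mu)) • (y - x))) + ‖q (x + (lam / (lam + mu)) • (y - x)) - (x + (lam / (lam + mu)) • (y - x))‖ ^ 2 / (2 * mu)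
      ≤ f y + ‖y - (x + (lam / (lam + mu)) • (y - x))‖ ^ 2 / (2 * mu) := hq _ hy
  have h3 : (f (q zs) + ‖q zs - zs‖ ^ 2 / (2 * mu)) + ‖zs - x‖ ^ 2 / (2 * lam) ≤
      (f (q (x + (lam / (lam + mu)) • (y - x))) + ‖q (x + (lam / (lam + mu)) • (y - x)) - (x + (lam / (lam + mu)) • (y - x))‖ ^ 2 / (2 * mu))
        + ‖(x + (lam / (lam + mu)) • (y - x)) - x‖ ^ 2 / (2 * lam) := hzs (mem_univ _)
  have h4 := twoStep_ge_oneStep hl hm f x (q zs) zs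
  show f (q zs) + ‖q zs - x‖ ^ 2 / (2 * (lam + mu)) ≤ f y + ‖y - x‖ ^ 2 / (2 * (lam + mu))
  linarith

/-- **THE VALUES AGREE: `e_λ(e_μ f)(x) = e_{λ+μ} f(x)`** at the minimisers — the outer minimum of the `μ`-envelope's `λ`-step equals the
`(λ+μ)`-step value at `q z⋆`. [folklore] -/
theorem twoStep_value_eq (hl : 0 < lam) (hm : 0 < mu) (hqK : ∀ z, q z ∈ K)
    (hq : ∀ z, IsMinOn (fun y => f y + ‖y - z‖ ^ 2 / (2 * mu)) K (q z)) {zs : E}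
    (hzs : IsMinOn (fun z => (f (q z) + ‖q z - z‖ ^ 2 / (2 * mu)) + ‖z - x‖ ^ 2 / (2 * lam)) univ zs) :
    (f (q zs) + ‖q zs - zs‖ ^ 2 / (2 * mu)) + ‖zs - x‖ ^ 2 / (2 * lam) = f (q zs) + ‖q zs - x‖ ^ 2 / (2 * (lam + mu)) := by
  have h1 := kernel_semigroup_eq hl hm x (q zs)
  have h2 : f (q (x + (lam / (lam + mu)) • (q zs - x))) +
        ‖q (x + (lam / (lam + mu)) • (q zs - x)) - (x + (lam / (lam + mu)) • (q zs - x))‖ ^ 2 / (2 * mu)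
      ≤ f (q zs) + ‖q zs - (x + (lam / (lam + mu)) • (q zs - x))‖ ^ 2 / (2 * mu) := hq _ (hqK zs)
  have h3 : (f (q zs) + ‖q zs - zs‖ ^ 2 / (2 * mu)) + ‖zs - x‖ ^ 2 / (2 * lam) ≤
      (f (q (x + (lam / (lam + mu)) • (q zs - x))) +
          ‖q (x + (lam / (lam + mu)) • (q zs - x)) - (x + (lam / (lam + mu)) • (q zs - x))‖ ^ 2 / (2 * mu))
        + ‖(x + (lam / (lam + mu)) • (q zs - x)) - x‖ ^ 2 / (2 * lam) := hzs (mem_univ _)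
  have h4 := twoStep_ge_oneStep hl hm f x (q zs) zs
  linarith

/-- **THE INTERMEDIATE KEPT VARIABLE LIES ON THE SEGMENT**: `z⋆ = x + (λ∕(λ+μ))•(q z⋆ − x)` — the outer minimiser is the point of
`[x, q z⋆]` at parameter `λ∕(λ+μ)` (§1's equality case). [folklore] -/
theorem intermediate_eq_of_twoStep (hl : 0 < lam) (hm : 0 < mu) (hqK : ∀ z, q z ∈ K)
    (hq : ∀ z, IsMinOn (fun y => f y + ‖y - z‖ ^ 2 / (2 * mu)) K (q z)) {zs : E}
    (hzs : IsMinOn (fun z => (f (q z) + ‖q z - z‖ ^ 2 / (2 * mu)) + ‖z - x‖ ^ 2 / (2 * lam)) univ zs) :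
    zs = x + (lam / (lam + mu)) • (q zs - x) := by
  have hv := twoStep_value_eq hl hm hqK hq hzs
  rw [← kernel_semigroup_eq_iff hl hm x (q zs) zs]
  linarith

/-- **CONVERSELY, FROM A `(λ+μ)`-MINIMISER — THE INNER STEP**: if `y⋆ ∈ K` minimises `y ↦ f y + ‖y − x‖²∕(2(λ+μ))` on `K`, then `y⋆`
minimises the inner `μ`-step `y ↦ f y + ‖y − z⋆‖²∕(2μ)` on `K` at the segment point `z⋆ := x + (λ∕(λ+μ))•(y⋆ − x)`. [folklore] -/
theorem isMinOn_innerStep_of_oneStep (hl : 0 < lam) (hm : 0 < mu) {ys : E}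
    (hmin : IsMinOn (fun y => f y + ‖y - x‖ ^ 2 / (2 * (lam + mu))) K ys) :
    IsMinOn (fun y => f y + ‖y - (x + (lam / (lam + mu)) • (ys - x))‖ ^ 2 / (2 * mu)) K ys := by
  intro y hy
  have h1 := kernel_semigroup_eq hl hm x ys
  have h2 : f ys + ‖ys - x‖ ^ 2 / (2 * (lam + mu)) ≤ f y + ‖y - x‖ ^ 2 / (2 * (lam + mu)) := hmin hy
  have h3 := twoStep_ge_oneStep hl hm f x y (x + (lam / (lam + mu)) • (ys - x))
  show f ys + ‖ys - (x + (lam / (lam + mu)) • (ys - x))‖ ^ 2 / (2 * mu) ≤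
    f y + ‖y - (x + (lam / (lam + mu)) • (ys - x))‖ ^ 2 / (2 * mu)
  linarith

/-- **CONVERSELY — THE OUTER STEP**: with `y⋆ ∈ K` a `(λ+μ)`-minimiser, `z⋆` its segment point and ANY selection `q` of inner `μ`-step
minimisers on `K`, `z⋆` minimises the outer `λ`-step of the `μ`-envelope over `E`. [folklore] -/
theorem isMinOn_outerStep_of_oneStep (hl : 0 < lam) (hm : 0 < mu) (hqK : ∀ z, q z ∈ K)
    (hq : ∀ z, IsMinOn (fun y => f y + ‖y - z‖ ^ 2 / (2 * mu)) K (q z)) {ys : E} (hys : ys ∈ K)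
    (hmin : IsMinOn (fun y => f y + ‖y - x‖ ^ 2 / (2 * (lam + mu))) K ys) :
    IsMinOn (fun z => (f (q z) + ‖q z - z‖ ^ 2 / (2 * mu)) + ‖z - x‖ ^ 2 / (2 * lam)) univ
      (x + (lam / (lam + mu)) • (ys - x)) := by
  intro z _
  -- g(z⋆) + kernel(z⋆) ≤ F(y⋆, z⋆) = one(y⋆) ≤ one(q z) ≤ F(q z, z) = g(z) + kernel(z)
  have h1 : f (q (x + (lam / (lam + mu)) • (ys - x))) +
        ‖q (x + (lam / (lam + mu)) • (ys - x)) - (x + (lam / (lam + mu)) • (ys - x))‖ ^ 2 / (2 * mu)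
      ≤ f ys + ‖ys - (x + (lam / (lam + mu)) • (ys - x))‖ ^ 2 / (2 * mu) := hq _ hys
  have h2 := kernel_semigroup_eq hl hm x ys
  have h3 : f ys + ‖ys - x‖ ^ 2 / (2 * (lam + mu)) ≤ f (q z) + ‖q z - x‖ ^ 2 / (2 * (lam + mu)) := hmin (hqK z)
  have h4 := twoStep_ge_oneStep hl hm f x (q z) z
  show (f (q (x + (lam / (lam + mu)) • (ys - x))) +
        ‖q (x + (lam / (lam + mu)) • (ys - x)) - (x + (lam / (lam + mu)) • (ys - x))‖ ^ 2 / (2 * mu))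
      + ‖(x + (lam / (lam + mu)) • (ys - x)) - x‖ ^ 2 / (2 * lam)
    ≤ (f (q z) + ‖q z - z‖ ^ 2 / (2 * mu)) + ‖z - x‖ ^ 2 / (2 * lam)
  linarith

/-- The `μ`-step minimisers are the minimisers of the tree's `proxFun (μ•f) z` (the two functionals differ by the factor `μ > 0`); any
normed group. [folklore] -/
theorem isMinOn_step_iff_isMinOn_proxFun_smul {F : Type*} [NormedAddCommGroup F] {μ : ℝ} (hμ : 0 < μ) (g : F → ℝ) (z p : F)
    (s : Set F) : IsMinOn (fun y => g y + ‖y - z‖ ^ 2 / (2 * μ)) s p ↔ IsMinOn (proxFun (μ • g) z) s p := by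
  have key : ∀ y, proxFun (μ • g) z y = μ * (g y + ‖y - z‖ ^ 2 / (2 * μ)) := fun y => by
    simp only [proxFun_apply, Pi.smul_apply, smul_eq_mul]
    field_simp
  constructor
  · intro h y hy
    show proxFun (μ • g) z p ≤ proxFun (μ • g) z y
    rw [key, key]
    exact mul_le_mul_of_nonneg_left (h hy) hμ.le
  · intro h y hy
    have h' : proxFun (μ • g) z p ≤ proxFun (μ • g) z y := h hy
    rw [key, key] at h'
    exact le_of_mul_le_mul_left h' hμ

/-! ## §3 In the tree's `prox` currency: the resolvent identity -/

section Prox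

variable [FiniteDimensional ℝ E]

/-- The tree's `prox (μ•f)` is a selection of `μ`-step minimisers (finite dimension, `f` convex). [folklore] -/
theorem isMinOn_step_prox_smul (hf : ConvexOn ℝ univ f) (hm : 0 < mu) (z : E) :
    IsMinOn (fun y => f y + ‖y - z‖ ^ 2 / (2 * mu)) univ (prox (mu • f) z) :=
  (isMinOn_step_iff_isMinOn_proxFun_smul hm f z _ univ).2 (isMinOn_prox (hf.smul hm.le) z)

/-- **THE RESOLVENT IDENTITY**: for `f` convex on a finite-dimensional space and `λ, μ > 0`,
`prox ((λ+μ)•f) x = prox (μ•f) (x + (λ∕(λ+μ))•(prox ((λ+μ)•f) x − x))` — the `(λ+μ)`-proximal point is the `μ`-proximal point of the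
segment point (§2's converse + uniqueness of the tree's minimiser). [folklore] -/
theorem prox_smul_add_eq_prox_smul_intermediate (hf : ConvexOn ℝ univ f) (hl : 0 < lam) (hm : 0 < mu) (x : E) :
    prox ((lam + mu) • f) x = prox (mu • f) (x + (lam / (lam + mu)) • (prox ((lam + mu) • f) x - x)) := by
  set ys := prox ((lam + mu) • f) x with hys
  have hone : IsMinOn (fun y => f y + ‖y - x‖ ^ 2 / (2 * (lam + mu))) univ ys :=
    (isMinOn_step_iff_isMinOn_proxFun_smul (add_pos hl hm) f x ys univ).2 (isMinOn_prox (hf.smul (add_pos hl hm).le) x)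
  have hinner := isMinOn_innerStep_of_oneStep (K := univ) hl hm hone
  have h1 : IsMinOn (proxFun (mu • f) (x + (lam / (lam + mu)) • (ys - x))) univ ys :=
    (isMinOn_step_iff_isMinOn_proxFun_smul hm f _ ys univ).1 hinner
  exact IsMinOn.eq_of_isMinOn_proxFun (hf.smul hm.le) h1 (isMinOn_prox (hf.smul hm.le) _)

/-- **TWO `prox` STEPS COMPOSE**: any outer minimiser `z⋆` of the `λ`-step of the `μ`-envelope (written through the tree's `prox (μ•f)`) has
`prox (μ•f) z⋆ = prox ((λ+μ)•f) x` and `z⋆ = x + (λ∕(λ+μ))•(prox ((λ+μ)•f) x − x)`. [folklore] -/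
theorem prox_comp_of_outerStep (hf : ConvexOn ℝ univ f) (hl : 0 < lam) (hm : 0 < mu) (x : E) {zs : E}
    (hzs : IsMinOn (fun z => (f (prox (mu • f) z) + ‖prox (mu • f) z - z‖ ^ 2 / (2 * mu)) + ‖z - x‖ ^ 2 / (2 * lam)) univ zs) :
    prox (mu • f) zs = prox ((lam + mu) • f) x ∧ zs = x + (lam / (lam + mu)) • (prox ((lam + mu) • f) x - x) := by
  have hq : ∀ z, IsMinOn (fun y => f y + ‖y - z‖ ^ 2 / (2 * mu)) univ (prox (mu • f) z) := isMinOn_step_prox_smul hf hm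
  have hone := isMinOn_oneStep_of_twoStep (K := univ) hl hm hq hzs
  have h1 : IsMinOn (proxFun ((lam + mu) • f) x) univ (prox (mu • f) zs) :=
    (isMinOn_step_iff_isMinOn_proxFun_smul (add_pos hl hm) f x _ univ).1 hone
  have heq : prox (mu • f) zs = prox ((lam + mu) • f) x :=
    IsMinOn.eq_of_isMinOn_proxFun (hf.smul (add_pos hl hm).le) h1 (isMinOn_prox (hf.smul (add_pos hl hm).le) x)
  refine ⟨heq, ?_⟩
  have h2 := intermediate_eq_of_twoStep (K := univ) hl hm (fun _ => mem_univ _) hq hzs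
  rwa [heq] at h2

/-- **UNIT KERNELS: THE PROXIMAL POINT OF THE ENVELOPE IS A MIDPOINT** — `prox (2•f) x = prox f (midpoint ℝ x (prox (2•f) x))`: a unit soft
step of the unit envelope is the double step, met halfway. [folklore] -/
theorem prox_two_smul_eq (hf : ConvexOn ℝ univ f) (x : E) :
    prox ((2 : ℝ) • f) x = prox f (midpoint ℝ x (prox ((2 : ℝ) • f) x)) := by
  have h := prox_smul_add_eq_prox_smul_intermediate hf one_pos one_pos x
  rw [one_smul, show (1 : ℝ) + 1 = 2 by norm_num] at h
  have hmid : midpoint ℝ x (prox ((2 : ℝ) • f) x) = x + (1 / 2 : ℝ) • (prox ((2 : ℝ) • f) x - x) := by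
    rw [midpoint_eq_smul_add, invOf_eq_inv]; module
  rw [hmid]; exact h

end Prox

/-! ## §4 Resistances add exactly: the modulus bookkeeping of the quadratic model (kernel checks) -/

/-- In the quadratic model `f = (m∕2)‖·‖²` the `λ`-envelope is `(m_λ∕2)‖·‖²` with `m_λ = m∕(1+λm)` (MEL's `m∕(1+m)` at `λ = 1`); the
semigroup is the identity `m_{λ+μ} = (m_μ)_λ`: `m∕(1+(λ+μ)m) = (m∕(1+μm))∕(1+λ·(m∕(1+μm)))` (`m, λ, μ ≥ 0`). -/
example {m lam mu : ℝ} (hm : 0 ≤ m) (hl : 0 ≤ lam) (hμ : 0 ≤ mu) :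
    m / (1 + (lam + mu) * m) = (m / (1 + mu * m)) / (1 + lam * (m / (1 + mu * m))) := by
  have h1 : 1 + mu * m ≠ 0 := by positivity
  have h2 : 1 + (lam + mu) * m ≠ 0 := by positivity
  field_simp
  ring

/-- Unit kernels twice: `m∕(1+m)` followed by `m′∕(1+m′)` is `m∕(1+2m)` — AFT's reciprocal recursion `γ′⁻¹ = γ⁻¹ + 1` with equality. -/
example {m : ℝ} (hm : 0 ≤ m) : (m / (1 + m)) / (1 + m / (1 + m)) = m / (1 + 2 * m) := by
  have h1 : 1 + m ≠ 0 := by positivity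
  field_simp
  ring

/-- Kernel toy on `ℝ`: with `λ = μ = 1`, `x = 0`, `y = 2` the segment point is `1` and both sides of §1 equal `1`. -/
example : ‖(2 : ℝ) - 1‖ ^ 2 / (2 * 1) + ‖(1 : ℝ) - 0‖ ^ 2 / (2 * 1) = ‖(2 : ℝ) - 0‖ ^ 2 / (2 * (1 + 1)) := by
  norm_num

end Summit.QuantumFields.BalabanUV.T4Continuum.NE7b.SoftStepSemigroup
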